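import Literature.NumberTheory.Transcendental.RoySmallValueStep1
import Literature.NumberTheory.Transcendental.RoySmallValueStep2Pkg
import Literature.NumberTheory.Transcendental.RoySmallValueBasic
import HarnessLib

/-!
# Roy's small value estimate for `𝔾ₐ × 𝔾ₘ` — §7 Step 1 in terms of Roy's body: `𝒟ʲP̃_D ∈ 𝒞_D`

Topic `Literature/NumberTheory/Transcendental`. Part of the formalisation of the proof of Roy 2013,
Theorem 1.1 (named fact `roy2013_thm_1_1`, `RoySmallValueEstimates.lean`), seat B. Source: D. Roy,
*A small value estimate for `𝔾ₐ × 𝔾ₘ`*, Mathematika 59 (2013) 333–363 = arXiv:1301.0663, §7,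
Step 1 (p. 18 of the arXiv text):

> We claim that, for any sufficiently large `D`, the polynomials `𝒟ʲP̃_D` with
> `0 ≤ j < 2⌊D^τ⌋` all belong to `𝒞_D`. To prove this, fix [...] `Q = 𝒟ʲP̃_D`. [...]
> `‖Q‖ ≤ D^j 𝓛(P̃_D) ≤ D^j (D+1)² ‖P_D‖` [...]
> `|𝒟ⁱQ(1,γ)| = |𝒟₁^{i+j}(X₁^a X₂^{−b} P_D(X₁,X₂))|_{X₁=ξ,X₂=η} ≤ [...]`.

With the parallel seat's `RoySmallValueStep1` (`royTilde`, `l1Norm_royTilde_le`,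
`norm_aeval_iterate_homD_royTilde_le`) and Roy's body `royBody D ξ η Y U T`
(`RoySmallValueStep2Pkg`), this file packages the claim with SYMBOLIC thresholds: if
`D^j (D+1)² H ≤ e^Y` (`‖P‖ ≤ H`) and `(2D+1)^{j+T} max{1,|ξ|}^D max{1,|η|⁻¹}^D W ≤ e^{−U}`
(`|𝒟₁ᵗP(ξ,η)| ≤ W` for `t < j + T`), then `𝒟ʲP̃_D ∈ 𝒞_D = royBody D ξ η Y U T`
(`iterate_homD_royTilde_mem_royBody`); moreover `𝒟ʲP̃_D` is the complexification of the integer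
form `𝒟ʲP̃_D ∈ ℤ[X]_D` (`map_iterate_homDK`, `isHomogeneous_iterate_homDK_royTilde`) — the shape
consumed by `RoySmallValueStep2Vanishing`. Everything is proved; no definitions, no named facts.

## References

* [Roy2013] D. Roy, *A small value estimate for 𝔾ₐ × 𝔾ₘ*, Mathematika 59 (2013), 333–363
  (arXiv:1301.0663), §7, Step 1.
-/

noncomputable section

open MvPolynomial Finset

namespace Literature.NumberTheory.Transcendental

namespace Roy2013

open Nesterenko

/-- `𝒟ʲP̃ ∈ ℤ[X]_D`. [cite: Roy2013, §7, Step 1] -/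
theorem isHomogeneous_iterate_homDK_royTilde {D : ℕ} {P : MvPolynomial (Fin 2) ℤ} (hP : P ≠ 0)
    (hD : P.totalDegree ≤ D) (j : ℕ) : ((homDK ℤ)^[j] (royTilde D hP)).IsHomogeneous D := by
  induction j with
  | zero => exact isHomogeneous_royTilde hP hD
  | succ j ih => rw [Function.iterate_succ_apply']; exact isHomogeneous_homDK ih

/-- **`𝒟ʲP̃_D ∈ 𝒞_D` under symbolic thresholds.** With `‖P‖ ≤ H`, `|𝒟₁ᵗP(ξ, η)| ≤ W` for
`t < j + T`, `D^j (D+1)² H ≤ e^Y` and `(2D+1)^{j+T} max{1,|ξ|}^D max{1,|η|⁻¹}^D W ≤ e^{−U}`: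
`𝒟ʲP̃_D ∈ royBody D ξ η Y U T`. [cite: Roy2013, §7, Step 1] -/
theorem iterate_homD_royTilde_mem_royBody {D : ℕ} {P : MvPolynomial (Fin 2) ℤ} (hP : P ≠ 0)
    (hD : P.totalDegree ≤ D) {ξ η : ℂ} (hη : η ≠ 0) (j : ℕ) {T : ℕ} {Y U H W : ℝ}
    (hH : (mvPolyHeight P : ℝ) ≤ H) (hW0 : 0 ≤ W)
    (hW : ∀ t < j + T, ‖aeval ![ξ, η] (royD^[t] P)‖ ≤ W)
    (hY : (D : ℝ) ^ j * (((D + 1) ^ 2 : ℕ) * H) ≤ Real.exp Y)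
    (hU : (2 * D + 1 : ℝ) ^ (j + T) * (max 1 ‖ξ‖ ^ D * max 1 ‖η‖⁻¹ ^ D) * W ≤ Real.exp (-U)) :
    homD^[j] (map (Int.castRingHom ℂ) (royTilde D hP)) ∈ royBody D ξ η Y U T := by
  have hPt := isHomogeneous_map_royTilde hP hD
  refine ⟨isHomogeneous_iterate_homD hPt j, ?_, fun i hi => ?_⟩
  · -- the norm
    calc maxNorm (homD^[j] (map (Int.castRingHom ℂ) (royTilde D hP)))
        ≤ l1Norm (homD^[j] (map (Int.castRingHom ℂ) (royTilde D hP))) := maxNorm_le_l1Norm _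
      _ ≤ (D : ℝ) ^ j * l1Norm (map (Int.castRingHom ℂ) (royTilde D hP)) := l1Norm_iterate_homD_le hPt j
      _ ≤ (D : ℝ) ^ j * (((D + 1) ^ 2 : ℕ) * mvPolyHeight P) :=
          mul_le_mul_of_nonneg_left (l1Norm_royTilde_le hP hD) (pow_nonneg (Nat.cast_nonneg _) _)
      _ ≤ (D : ℝ) ^ j * (((D + 1) ^ 2 : ℕ) * H) := by gcongr
      _ ≤ Real.exp Y := hY
  · -- the values
    rw [← Function.iterate_add_apply]
    have hval := norm_aeval_iterate_homD_royTilde_le hP hD hη (i + j) (W := W)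
      (fun t ht => hW t (by omega))
    refine hval.trans (le_trans ?_ hU)
    have hC : 0 ≤ max 1 ‖ξ‖ ^ D * max 1 ‖η‖⁻¹ ^ D := by positivity
    have hpow : (2 * D + 1 : ℝ) ^ (i + j) ≤ (2 * D + 1 : ℝ) ^ (j + T) :=
      pow_le_pow_right₀ (by linarith [(Nat.cast_nonneg D : (0 : ℝ) ≤ D)]) (by omega)
    exact mul_le_mul_of_nonneg_right (mul_le_mul_of_nonneg_right hpow hC) hW0

/-- The same, for the complexification of the integer form `𝒟ʲP̃_D` (the shape used to make the
integer forms of `𝒞_D` vanish on the selected orbit). [cite: Roy2013, §7, Steps 1–2] -/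
theorem map_iterate_homDK_royTilde_mem_royBody {D : ℕ} {P : MvPolynomial (Fin 2) ℤ} (hP : P ≠ 0)
    (hD : P.totalDegree ≤ D) {ξ η : ℂ} (hη : η ≠ 0) (j : ℕ) {T : ℕ} {Y U H W : ℝ}
    (hH : (mvPolyHeight P : ℝ) ≤ H) (hW0 : 0 ≤ W)
    (hW : ∀ t < j + T, ‖aeval ![ξ, η] (royD^[t] P)‖ ≤ W)
    (hY : (D : ℝ) ^ j * (((D + 1) ^ 2 : ℕ) * H) ≤ Real.exp Y)
    (hU : (2 * D + 1 : ℝ) ^ (j + T) * (max 1 ‖ξ‖ ^ D * max 1 ‖η‖⁻¹ ^ D) * W ≤ Real.exp (-U)) :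
    map (Int.castRingHom ℂ) ((homDK ℤ)^[j] (royTilde D hP)) ∈ royBody D ξ η Y U T := by
  rw [map_iterate_homDK]
  exact iterate_homD_royTilde_mem_royBody hP hD hη j hH hW0 hW hY hU

end Roy2013

end Literature.NumberTheory.Transcendental
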